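import Mathlib
import HarnessLib
import HarnessLib.Audit
import Summits.AtomisticToContinuum.Statement
import HarnessLib.Audit.Check
import Literature.MathematicalPhysics.StatisticalMechanics.LennardJonesClusters
import Literature.MathematicalPhysics.StatisticalMechanics.BarlowStacking
import Literature.MathematicalPhysics.StatisticalMechanics.HaggStacking
import Summits.AtomisticToContinuum.Crystallization.Theses.HullMinimality
import Summits.AtomisticToContinuum.Crystallization.Theorems.ReggeStarCoercivityDefectFreeCrystallizesHullCriterion
import Summits.AtomisticToContinuum.Crystallization.Theorems.PhononSlackCertificatesWindowOptimality
import Summits.AtomisticToContinuum.Crystallization.Theorems.ExcessDecayLiouvilleCrysEnergyLimit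
import HarnessLib.Audit.Status.Attr

/-!
Route: SpectralChargeLedger

DORMANT since 2026-08-26T14:57:35Z (reconciler: no traction for 6.7 d (last activity item-proof-filed at 2026-08-19T22:25:47Z); parked, not closed — `ledger route dormant route-AtomisticToContinuum-SpectralChargeLedger --off` to reactiv) — unstaffed, not closed; items shared with open routes are served there. `ledger route dormant <id> --off` reactivates.

# Route SpectralChargeLedger — a summed shell-pricing ledger for Lennard-Jones (Garland's conserved
spectral charge as its transfer currency); exact shells then layer

It suffices to show X = K1 ∧ K2 (realising card garland-hodge-balance, critic-graded new-mechanism;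
planner deltas below; K1 REPAIRED 2026-08-17 after the refutation of the sitewise pricing
stmt-17253).
Attach to every site i of a finite configuration y the SPECTRAL CHARGE Φ_i := Σ_(link edges jk at i)
w_ijk·|y_j − y_k|² − ½·Σ_(bonds ij) m_ij·|y_i − y_j|²
(bonds: 0 < |y_i − y_j| ≤ 6/5·a₀; canonical triangle weight w = 1/3 on doubly-capped triangles, 1
otherwise; m_ij = Σ_k w_ijk). Garland's
localisation identity read with the IDENTITY MAP as 1-cocycle is an exact CONSERVATION LAW Σ_i Φ_i =
0 on every finite configuration
(double counting; support ChargeConservation); per-site Poincaré on the link makes Φ_i ≥ (½ − λ₂)W_i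
− λ₁M_i|c_i|²: icosahedral stars carry
+0.053·W (tight: +1.056 on the LJ₁₃ icosahedron), the decahedral D5h axis shell +0.356, every
relaxed Barlow star EXACTLY 0 (forced: Σ_i Φ_i = 0 +
vertex-transitivity) and stationary, dilated / negative-disclination stars < 0.
K1 = SummedShellPricing (the ledger in SUMMED form — exactly what `closes` consumes): for every
separation δ > 0 there is a relaxed-Barlow cell
(a₀, h₀) in the box such that for every tolerance τ ∈ (0,1] some κ > 0 gives κ·#B ≤ E(y) − N·e⋆ for
every finite δ-separated configuration y and
every set B of sites whose 13/10·a₀-shell is NOT τ-matched (linear isometry + bijection) to the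
12-shell of hcpStacking a₀ h₀ or fccStacking a₀ h₀
(e⋆ = ⨅ periodic energy per particle; B = ∅ is the finite bulk floor E(y) ≥ N·e⋆, true by Fekete +
CrysEnergyLimit). The charge is the route's
device for PROVING K1: price sitewise, x_i + α·Φ_i ≥ κ·1_bad(i), with a local excess x_i whose
bookkeeping is ADAPTED to the configuration, then
sum and use Σ_i Φ_i = 0 — a FIXED sharp bookkeeping cannot be a hypothesis: linear-in-τ pricing is
refuted by dilated ground states (stmt-17253,
SpectralChargeLedgerOneMultiplierPricing_refuted), and any configuration-independent sitewise form,
quadratic included, falls to near-field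
stuffing (attractive matter placed just outside the averaging ball drives x_i < 0 at a perfect
Barlow centre, where Φ_i = 0) combined with
neutral-defect charge cancellation (one displaced atom: ΔΦ is supported on the 13 τ-bad sites and
sums to 0, so some bad site has Φ ≤ 0 while
its ball-averaged excess is O(d²/r³)); the summed inequality is immune to all three (global
bookkeeping: far matter pays its own surface energy).
K2 = ShellsToLayers: τ-exact shells on a large ball give an ε-layered window (pure geometry, τ → 0
by compactness). K1 on ground states with
E(N) − N·e⋆ = o(N) gives o(N) τ-bad sites, hence an all-τ-good R'-ball eventually (packing), hence
LayeredWindows (stmt-11778's format) — and the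
PROVED chain PeriodicGivenLayered_of (11779) → stub_hullCriterion (3243) → windowOptimality_proof
(13962) + crysEnergyLimit_proof (0626) gives
both conjuncts.
Lean: `SummedShellPricing ∧ ShellsToLayers`

## Assembly
Certified sorry-free (glue.lean, lean check rc 0, axioms propext · Classical.choice · Quot.sound;
re-certified 2026-08-17 for the repaired K1):
given a ground-state sequence x, take δ from LennardJonesMinimalDistance_holds and (a₀, h₀) from K1;
for a scale (R, ε) take (τ, R') from K2 and
κ = κ(τ) from K1; inside `closes`: (a) κ·#bad_τ(x^N) ≤ E(x^N) − N·e⋆ (K1 with B = the τ-bad set),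
(d) E(N) − N·e⋆ < θN eventually with
θ = κ/(2M), M = (2R'/δ + 1)³ (crysEnergyLimit_proof), (e) the packing count N ≤ #bad_τ·M if every
site had a τ-bad site within R'
(card_le_of_separated_of_dist_le) — contradiction, so eventually some site has an all-τ-good
R'-ball, K2 gives the layered window, i.e.
LayeredWindows for x; then the twin h3 of PeriodicGivenLayered_of (stmt-11779, PROVED) gives
PeriodicWindows, stub_hullCriterion (3243, PROVED)
gives IsCrystallizing, and for a ground-state sequence from LennardJonesGroundStatesExist_holds,
windowOptimality_proof (13962, PROVED) +
crysEnergyLimit_proof (0626, PROVED) give HasPeriodicGroundStateEnergy. `closes` takes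
SummedShellPricing, ShellsToLayers and, as h3, the
stacking-selection statement PeriodicGivenLayered (verbatim twin of the PROVED stmt-11779, filed
here as a rank-9 crux — see IMPORT CONE).
IMPORT CONE (route-repair 2026-08-16, unit rrepair-AtomisticToContinuum-SpectralC-d8818381): the 13
unproved module-cone facts at open were the summit's six own open conjunct statements riding on the
gate auto-import Summits.AtomisticToContinuum.Statement (uncontrollable baseline, as for every route
of this summit) plus seven passengers of two imports nothing load-bearing needed:
FejesTothKissingTwelve, flyspeck_L12, Hales2012_kissingTwelve / _contactGraphFccOrHcp /
_kissingConfigCongruent via Literature.Barriers.AtomisticToContinuum.FlexibleKissingArrangements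
(used only to name the icosahedral vertex set of the support IcosahedralPoincareCharge — restated
rev 1 over an inlined integer icosahedron), and NumberField.ExtendedRiemannHypothesis / ′ via
Theorems.PhononSlackCertificatesPeriodicGivenLayered → …Registry3 →
Literature.Algebra.EuclideanLattices.GaussianLatticeSums → DedekindZeta* (the ERH conjectures are
merely DECLARED in DedekindZeta.lean; the proved stacking selection does not use them). Both imports
dropped (rev 3); stacking selection now enters `closes` as hypothesis h3 and is to be closed by a
one-line Theorems file `theorem … : SpectralChargeLedger.PeriodicGivenLayered :=
LayeredHull.PeriodicGivenLayered_of` that imports THIS route file (cycle-safe: no import is added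
here). needs-fact: none. Library note for the operator/librarian: moving the three ERH conjecture
decls out of Literature/NumberTheory/LFunctions/DedekindZeta.lean (or cutting the
GaussianLatticeSums → DedekindZetaThetaProofs edge) would clean the cone of every route that links
PeriodicGivenLayered_of (DisclinationRation, FluxTubeKepler carry the same passenger).

Rationale: WHY THIS LINE. Mechanism (card garland-hodge-balance; Garland1973, BallmannSwiatkowski1997,
Oppenheim2017 — spectral geometry of simplicial complexes, the
engine of property (T) and high-dimensional expanders, never pointed at packings): three-dimensional
frustration theory lacks a global
relation of Gauss–Bonnet type (SadocMosseri1999 §4.3.3, Nelson1983; barrier TetrahedralFrustration),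
so every local energy lemma on this
summit needs DESIGNED transfers (LP duals, Regge stars, Euler-on-links, radius-4 charts); here the
transfer rule is FIXED by geometry — the
Garland charge with the canonical weight, whose threshold ½ IS the frustration angle
(2λ₁(icosahedron) = 1.0515² = the forced tangential
stretch of twelve kissing balls) — and only its multiplier α is free. Planner deltas w.r.t. the
card: (Δ1) identity-map cocycle instead of
harmonic correctors on T³ — no Hodge non-degeneracy crux (the card's K2 is killed by cracks on the
torus; here the law is exact on finite
clusters, no hull, no torus); (Δ2) BOTH Barlow stars carry charge exactly 0 (conservation +
vertex-transitivity) and are critical points of Φ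
(support BarlowChargeSecondOrder), so pricing is second-order-consistent with elasticity and
polytype-agnostic (ShortRangeStackingBlindness
respected; selection is the PROVED stmt-11779); (Δ3, repaired 2026-08-17) the energetic crux is the
SUMMED ledger inequality
SummedShellPricing — the only form of the pricing `closes` ever consumed — and the charge is the
proof device, not a hypothesis: the sitewise
form with a fixed bookkeeping was refuted linear-in-τ by dilated ground states
(SpectralChargeLedgerOneMultiplierPricing_refuted, virial
identity: elastic cost is quadratic) and is refutable in ANY configuration-independent form by
near-field stuffing + neutral-defect charge
cancellation (thesis), whereas a proof may choose its local excess per configuration. What no listed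
route does: PricedLinkCensus prices an
Euler identity on EACH link at the fixed tolerance 1/100 with an N^(2/3) allowance (stmt-14231),
ReggeStarCoercivity uses metric dihedral
flatness + star LPs, DisclinationRation rations five-fold AXES by Gauss–Bonnet on 2-D sections,
HcpDefectCounting posits a radius-4
hcp-ONLY counting inequality at e(hcp a h) CONDITIONAL on the bulk floor (stmt-14476/14477); here
the count is of FIRST shells of EITHER Barlow
letter, unconditional (e⋆ itself), at every tolerance τ with κ(τ) free, and the suggested transfer
currency is a conserved, metric-robust,
graph-typed charge that is positive exactly on the soft frustrated defects (icosahedral, D5h — the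
witness that refuted stmt-4146) and zero on
every Barlow star. Imported areas: p-adic curvature / Garland method (spectral geometry),
discharging (combinatorics), discrete elasticity
(second-order stationarity); no Fourier/LP certificate, no potential class, no limit object.

RANKED CRUXES. #2 SummedShellPricing (crux; repaired K1, replaces the refuted OneMultiplierPricing
stmt-17253) — for every separation δ > 0 there is a relaxed-Barlow cell (a₀, h₀) in the box (47/50 ≤
a₀ ≤ 1, |h₀ − a₀√(2/3)| ≤ a₀/100) such that for every tolerance τ ∈ (0,1] some κ > 0 makes κ·#B ≤
E(y) − N·e⋆ for every finite δ-separated configuration y and every set B of sites whose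
13/10·a₀-shell is NOT τ-matched (after a linear isometry, bijectively) to the 12-shell of
hcpStacking a₀ h₀ or of fccStacking a₀ h₀; e⋆ = ⨅ periodic LJ energy per particle. [difficulty:
open-problem] (why it might fail: (a₀, h₀) must be the EXACT asymptotic ground-state cell (E(N) −
N·e⋆ = o(N) forces it) and serve both shell letters: false if the bulk minimiser is not hcp/fcc with
a single interlayer gap (relaxed 6H/9R-type or non-Barlow order), or if some τ-defect family has
excess/#bad → 0 (soft mode, degenerate fault relaxation).) [Theil2006, FlatleyTheil2015,
BlancLewin2015, Stillinger2001, HalesDSP2012,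
Literature.Barriers.AtomisticToContinuum.TetrahedralFrustration,
Literature.Barriers.AtomisticToContinuum.DecahedralSoftShell,
Literature.Barriers.AtomisticToContinuum.ShortRangeStackingBlindness]
#3 ShellsToLayers (crux) — (pure geometry, finite radius, exactness τ → 0) for every (a₀, h₀) in the
box, every δ > 0 and every R, ε > 0 there are τ ∈ (0,1] and R' such that in every δ-separated finite
configuration, a site all of whose neighbours within R' have 13/10·a₀-shells τ-matched to the
relaxed hcp or fcc 12-shell at scale (a₀, h₀) carries a window: some translate of the configuration
is two-way ε-matched on B(0,R) with a rigid image of a layered Barlow-type set with in-layer spacing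
a₀, a Hägg word s and free heights with increments in [39a₀/50, 17a₀/20] (exactly the window format
of LayeredWindows, stmt-11778). [difficulty: L] (why it might fail: Only the exact case is in tree
(HalesDSP_layerPackings, ExactHcpLocalTheorem); at h₀ = a₀√(2/3) exactly the τ-robust step meets the
Böröczky–Szabó / KKLS flexible twelve-neighbour threats and must come from compactness in τ at fixed
(R, ε), not from a fixed tolerance.) [HalesDSP2012, Hales2012, BoroczkySzabo2016,
KusnerKusnerLagariasShlosman2018, DolbilinLagariasSenechal1998]
#9 ChargeConservation (support) — the conservation law: for every a₀ and every finite configuration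
y in ℝ³, Σ_i Φ_i = 0 (Garland's localisation with the identity cocycle = double counting of weighted
squared edge lengths over triangles; a full proof is attached as evidence on stmt-17255).
[difficulty: provable-now] [Garland1973, BallmannSwiatkowski1997]
#9 BarlowChargeSecondOrder (support) — relaxed Barlow stars are critical points of the charge: for
(a₀, h₀) in the box there are C, η₀ > 0 such that an η-matched (η ≤ η₀) hcp- or fcc-shelled site has
|Φ_i| ≤ C·η² (hand computation of ∂Φ/∂y_j = 2Σ_k c_ijk(y_j − y_k) − m_ij(y_j − y_i) = 0 at both
stars for every interlayer spacing; numerics: Φ(centre) = O(ε²) under random ε-perturbations of fcc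
and hcp clusters; refuter re-check 2026-08-17: centres 0 for h ∈ {ideal, .80, .83}). [difficulty: M]
[Garland1973, HalesDSP2012, FlatleyTheil2015]
#9 PeriodicGivenLayered (crux, rank 9) — stacking selection inside the hull: for every sequence of
LJ ground states, layered windows at every scale (LayeredWindows format) imply periodic windows at
every scale; verbatim twin of stmt-11779 (HullMinimality rank-3 crux, PROVED 2026-08-16 by
LayeredHull.PeriodicGivenLayered_of), re-filed here only because `closes` must take it as a
hypothesis (its proof module cannot be imported without the ERH passenger, see IMPORT CONE in the
thesis); close it by the one-line Theorems file importing this route file. [difficulty: proved-twin]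
(why it might fail: mathematically it cannot; procedural risk only — a `_holds` link to the existing
proof would re-import the ERH-carrying cone.) [LoachAckland2017, BlancLewin2015,
Literature.Barriers.AtomisticToContinuum.ShortRangeStackingBlindness]
#9 IcosahedralPoincareCharge (support) — Garland–Poincaré for the icosahedral link (the source of
the + sign on frustrated stars), over an INLINED integer icosahedron (rev 1; no Literature.Barriers
import): with c the twelve integer vectors (0, ±28, ±45) and cyclic permutations (the tree's
rational icosahedron ×53) and u ~ v iff 0 < |c_u − c_v|² < 4045 (the icosahedral graph: 5-regular,
30 edges), for every p : Fin 12 → ℝ³ with Σ p = 0: (1 − 1/√5)·5·Σ‖p_u‖² ≤ ½·Σ_(ordered adjacent)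
‖p_u − p_v‖² (λ₁ of the icosahedral graph Laplacian = 5 − √5; equality at the regular icosahedral
star, whence Φ_centre = +(½ − 1/√5)·W = +1.056 on LJ₁₃). [difficulty: provable-now] [Garland1973,
Oppenheim2017]
Negative edge (settled): OneMultiplierPricing (stmt-17253, the sitewise linear pricing) — REFUTED
2026-08-17 by SpectralChargeLedgerOneMultiplierPricing_refuted (helpers
Theorems/OneMultiplierPricing/Negative/{Virial,BarlowShellDilation}.lean: virial identity of a
minimiser, 𝓔((1+s)x) − 𝓔(x) ≤ 36 s²|𝓔(x)|, shell enumeration on the box); never to be re-filed in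
any sitewise fixed-bookkeeping form (see thesis).

TWO-LAYER PLAN. Foreseen glued splits (none filed now). SummedShellPricing ⇐ FiniteBulkFloor (B = ∅:
E(y) ≥ N·e⋆ for every finite y — Fekete
superadditivity of N ↦ 𝓔(N) over far-apart copies + crysEnergyLimit_proof; provable now, cf.
HcpDefectCounting's MinimiserGivesFloor) → NearBarlowPricing
(perturbative regime: configurations all of whose sites are 1/20-good — κ(τ) ~ τ² from
BarlowChargeSecondOrder + uniform polytype phonon stability,
cf. stmt-15800; the dilation witness shows κ(τ) ≤ 36|e⋆|·(τ/ρ)²-type is forced) → CensusPricing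
(O(1) regime: a finite spectral census of
δ-separated two-shell types with certified LJ energetics, priced sitewise by x_i + α·Φ_i with a
configuration-adapted local excess and summed
with Σ_i Φ_i = 0; the single exchange-rate inequality max_(Φ>0)(−x/Φ) < min_(bad, Φ<0)(x/|Φ|) is the
device's own falsifier) →
SummedShellPricing (k = 3). ShellsToLayers ⇐ ExactShellsLayered (τ = 0 at finite radius:
HalesDSP_layerPackings at the ideal ratio, metric
pinning of the hexagon plane off it, as in the proved ExactHcpLocalTheorem but with both letters) →
CompactnessUpgrade (τ > 0 at fixed (R, ε)) →
ShellsToLayers (k = 2).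

KILL CRITERIA. refuted:SummedShellPricing by an explicit finite δ-separated family with
excess/#bad_τ → 0 at a FIXED τ for every cell (a₀, h₀) in the box — a
zero-cost τ-defect (soft inner mode, fault relaxation of amplitude > τ at energy o(1) per affected
site), a non-Barlow or two-gap polytype bulk
phase at e⋆, or ground-state sequences whose shells do not converge to one cell — ⇒ close refuted
(no cheaper energetic statement feeds
`closes`; the charge supports survive as Literature-grade lemmas). refuted:ShellsToLayers (an
everywhere-exact-shelled non-layered configuration at
some (a₀, h₀)) ⇒ restate with h₀ ≠ a₀√(2/3) pinned or import the exact Hales theorem as hypothesis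
(pivot, not close). LayeredWindows
(stmt-11778) or ZeroDefectDensity + RobustBarlowTemplate proved on another route moots this one;
HcpDefectCoercivity + HcpBulkFloor
(route HcpDefectCounting) proved would imply K1 at each τ only after a first-shell/radius-4
comparison — not automatic, both stay staffed.

NOT DECOMPOSED YET. The modulus κ(τ): quadratic κ·τ² is the expected truth (elasticity; the
dislocation log and the vacancy 1/r³ field are consistent with it)
but only ∀τ ∃κ is filed — the weakest form `closes` needs; the sitewise device (local excess x_i,
its radius and kernel, the multiplier α,
bond cutoff 6/5, shell cutoff 13/10 — the last two are the tree's conventions, the weight 1/3 is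
canonical and NOT free); the spectral census
itself (which shell graphs occur δ-separated below e⋆ + η and their λ₂ — Z12 0.447, cubocta ½,
anticubocta^w ½, bcc-14 ½, Z14 0.546, Z16 0.573
by the card); the edge law (E) (harmonic-weighted Coxeter 5.1043) and the torus/corrector version —
not needed by `closes`; any
identification of the window's word (never needed: selection is proved).

CHEAPEST FALSIFIER. The defect-price scan (kills K1 itself): for τ ∈ {0.02, 0.05, 0.1} and the
LJ-optimal hcp cell tabulate (E − N·e⋆)/#bad_τ over a zoo — bcc,
A15, C15, σ, Z-phase supercells at their LJ-optimal scale; Mackay / anti-Mackay icosahedra,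
Ino/Marks decahedra; hcp/fcc with vacancy,
interstitial, stacking fault, twin, Σ3/Σ5 grain boundaries, (0001)/(111) surfaces, relaxed 4H/6H/9R
polytypes (two-gap relaxation amplitude
versus fault energy ≈ 6e-5 per column is the sharpest single number); LJ glass inherent structures —
and check the ratio stays bounded below
(expected ≥ 1e-5 at τ = 0.02). One numpy kit job (≈ 10⁴ sites, minutes); not yet run. The
exchange-rate scan of the original plan (x_i, Φ_i,
good/bad for r ∈ {2, 3, 4} over the same zoo) falsifies the DEVICE, not K1. Already checked (pure
python, refuter re-check 2026-08-17 included):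
λ₂(cubocta) = 0.5000, λ₂(anticubocta) = 0.5215 unit / 0.5000 canonical, λ₂(icosahedron) = 0.4472 =
1/√5; Σ_i Φ_i = 0 to rounding on random
40-clusters; Φ(LJ₁₃ icosahedron centre) = +1.0557 = (½ − 1/√5)·W exactly, shell sites −0.088 each;
Φ(fcc centre) = Φ(hcp centre) = 0 for
h ∈ {ideal, 0.80, 0.83} and O(ε²) under random ε-perturbations (ε = 1e-2 → ≤ 1.6e-3, ε = 1e-3 → ≤
1.6e-5); Φ(D5h decahedral-axis shell of
barrier DecahedralSoftShell) = +0.356.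

NUMBERS. LJ units V = r⁻¹²/12 − r⁻⁶/6: e⋆ ≈ e(hcp) = −0.717591, e(fcc) = −0.717519 (Δ = 7.2e-5), bcc
+4.3 %, A15 +12 %, C15 +18 % (tree numerics of
route SumsetDoublingRigidity); nearest-neighbour distance 0.9712 (∈ [47/50, 1]); ideal h/a = √(2/3)
= 0.8165 ∈ [39/50, 17/20]. Dilation
(refutation of 17253): 𝓔((1+s)x) − 𝓔(x) ≤ 36 s²|𝓔(x)| ≈ 26 s² per site for a ground state, shells
then (s·ρ)-off with ρ = max(a₀, √(a₀²/3 + h₀²))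
≤ 1.01 a₀ — so κ(τ) ≲ 1e2·τ² is forced and κ(1) ≤ −e⋆ ≈ 0.72 (N = 1), κ(1) ≤ (e(bcc) − e⋆) ≈ 0.031
(14-point shells). Spectral census (RW second
eigenvalue of the link): icosahedron 1/√5 = 0.4472 (charge +0.0528·W), cuboctahedron ½,
anticuboctahedron 0.5215 (unit) / ½ (canonical
weight 1/3 on the three doubly-capped basal triangles), Z14 (1+√3)/5 = 0.5464, Z16 0.5726, bcc-14 ½.
Charges at unit bond length: LJ₁₃
icosahedron centre +1.0557 (W = 20), its shell sites −0.0880; D5h axis shell +0.3564 (W = 36.2).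
Frustration angle: 2π − 5·arccos(1/3) =
7.36°; 2λ₁(ico) = 1.1056 = 1.0515². Packing constant in `closes`: M = (2R'/δ + 1)³ with δ the LJ
minimal distance (1/3 in tree), θ = κ/(2M).

DEFINITION REQUESTS. None (local excess, charge and shell matching are inlined over
siteEnergy/interactionEnergy, hcpStacking/fccStacking, Finset sums). If the
device is vendored later: notions `spectralCharge` (canonical-weight Garland charge of a site) and
`localExcess` under
Literature/Geometry/DiscreteGeometry — not filed now.

Novelty: Searches (2026-08-16, at open): grep of all 79 Crystallization theses for garland|bochner|λ₂ (0
uses; DisclinationRation and GappedShellCensus only CITE the card); the card's own logged searches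
(hybrid "Garland method vanishing cohomology link spectral gap simplicial complex" 0, zbMATH
"trickle down theorem local spectral expander" 2, "Garland p-adic curvature" 2, "statistical
honeycomb Coxeter 5.104" 0, galaxy saturated); lit frontier AtomisticToContinuum --since 2022 (40
rows; arXiv:2604.19239 Kreutz–Ziereis polycrystal Γ-limits and arXiv:2407.20762 planar
arbitrary-norm crystallization read — neither spectral); arXiv:2209.14880 read pp.1–5 (ℓ¹-slicing,
2-D, three-body); ledger negatives; lean search: no Garland/link-spectral decls in Mathlib or tree
beyond SimpleGraph.lapMatrix. Repair session (2026-08-17): lit search --hybrid "energy excess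
controls number of defects crystallization Lennard-Jones three dimensions" and "ground state energy
bounds number of defects … local minimality" (10+10 rows: textbooks + arXiv:2107.14020
Bétermin–Šamaj–Travěnec lattice-restricted LJ minimisation — no unrestricted 3-D defect-counting
bound in print; BlancLewin2015: 3-D LJ crystallization open; FlatleyTheil2015 needs an added
three-body term; Theil2006 is 2-D); ledger negatives --problem AtomisticToContinuum (20 entries;
17253 is this route's own, 15929/4146/3506 addressed: no fixed-tolerance census or local
classification is claimed, K2 carries δ-separation); in-tree siblings of the re  [refs: 2604.19239, 2407.20762, 2209.14880, 2107.14020, 2210.00158, BlancLewin2015, FlatleyTheil2015, Theil2006, Garland1973, BallmannSwiatkowski1997, Oppenheim2017, SadocMosseri1999]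

Barriers (technique_class: spectral-balance, garland-poincare, discharging): - technique_class: spectral-balance, garland-poincare, discharging
- Literature.Barriers.AtomisticToContinuum.TetrahedralFrustration: quantified, not evaded — the
regular tetrahedron's angle deficit reappears as the spectral threshold (2λ₁(icosahedron) = 1.0515²,
Φ_ico = +1.056 tight); the law is the global relation the barrier says is missing, and K1 prices
frustration THROUGH it rather than by a per-cell bound.
- Literature.Barriers.AtomisticToContinuum.DecahedralSoftShell: the D5h witness that refuted
EffectiveLocalHales (stmt-4146) at 1 % tolerance is here a POSITIVELY charged shell (+0.356): K1
gives it room α·0.356 instead of classifying it as good or pricing it at its 0.67 %-strain energy;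
K2 never sees it (exactness τ → 0).
- Literature.Barriers.AtomisticToContinuum.IcosahedralClusters: respected — finite clusters are free
to be icosahedral: on LJ₁₃ the conservation law is paid by the twelve surface sites (−0.088 each);
only bulk density is constrained, via E − N·e⋆ = o(N).
- Literature.Barriers.AtomisticToContinuum.FlexibleKissingArrangements: the contact-free icosahedral
shell has tangential edges 1.0515·a < 6/5·a, so at the chosen bond cutoff its link IS the
icosahedron and the charge is visible; flexing inside the 1/40-neighbourhood keeps the graph type,
hence λ₂, and moves Φ continuously — the cutoff 6/5 is chosen for this.
- Literature.Barriers.AtomisticToContinuum.KissingTwelveDegeneracy: respected — cubocta and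
(canonically weighted) anticubocta links are both

History (route lifecycle, newest last):
- 2026-08-16T23:25:16Z · rev 1: restated IcosahedralPoincareCharge (stmt-AtomisticToContinuum-17257) — route-repair (cone): restate support IcosahedralPoincareCharge over an inlined integer icosahedron so the route no longer needs Literature.Barriers.AtomisticToC (planner-rrepair-AtomisticToContinuum-SpectralC-d8818381-0)
- 2026-08-17T00:32:02Z · BROKEN — OneMultiplierPricing (stmt-AtomisticToContinuum-17253, crux) refuted by Summit.AtomisticToContinuum.Crystallization.Theorems.SpectralChargeLedgerOneMultiplierPricing_refuted @ 7c30f6ed2fe2 (refuter-rreview-0816T23-0-0)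
- 2026-08-17T01:05:22Z · rev 6: restated OneMultiplierPricing (stmt-AtomisticToContinuum-17253 refuted), Assembly (stmt-AtomisticToContinuum-17258) — repair: OneMultiplierPricing (stmt-17253) refuted-misstated by SpectralChargeLedgerOneMultiplierPricing_refuted (dilated ground states: linear-in-τ pricing vs q (planner-rfix-AtomisticToContinuum-SpectralCh-d8818381-0)
- 2026-08-17T01:05:22Z · REPAIRED (restate OneMultiplierPricing, Assembly) — back to open: repair: OneMultiplierPricing (stmt-17253) refuted-misstated by SpectralChargeLedgerOneMultiplierPricing_refuted (dilated ground states: linear-in-τ pricing vs q (planner-rfix-AtomisticToContinuum-SpectralCh-d8818381-0)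
- 2026-08-26T14:57:35Z · DORMANT — reconciler: no traction for 6.7 d (last activity item-proof-filed at 2026-08-19T22:25:47Z); parked, not closed — `ledger route dormant route-AtomisticToContinuu (operator:999:3639802)

sub-problem: Crystallization · status: dormant · opened planner-plan-novel-AtomisticToContinuum-Crystal-ad211d65-v2-g8-0 2026-08-16T23:08:28Z · rev 7 · ledger route-AtomisticToContinuum-SpectralChargeLedger
GENERATED by the gate from the ledger (D-0016/17). Provers cite these decls: `theorem foo : Summit.AtomisticToContinuum.Crystallization.Theses.SpectralChargeLedger.<Decl> := …` in Summits/AtomisticToContinuum/Crystallization/Theorems/<Name>.lean.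
-/

namespace Summit.AtomisticToContinuum.Crystallization.Theses.SpectralChargeLedger

open scoped BigOperators Topology Manifold Classical MeasureTheory ProbabilityTheory Matrix InnerProductSpace ComplexConjugate ContinuousMap
open Filter Set Function TopologicalSpace MeasureTheory

attribute [summit_statement] _root_.Crystallization

/-- item stmt-AtomisticToContinuum-17044 · crux · rank 2 · open · by planner
why it might fail: (a₀,h₀) must be the EXACT asymptotic ground-state cell and serve both shell letters: false if the bulk LJ minimiser is not hcp/fcc with one interlayer gap (relaxed 6H/9R-type, non-Barlow), or if some τ-defect family has excess/#bad → 0 (soft mode, degenerate fault relaxation).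
sources: Theil2006, FlatleyTheil2015, BlancLewin2015, Stillinger2001, HalesDSP2012, Literature.Barriers.AtomisticToContinuum.TetrahedralFrustration
[crux] (K1, repaired 2026-08-17: the SUMMED ledger inequality — exactly what `closes` consumes;
replaces the refuted sitewise OneMultiplierPricing stmt-17253) for every separation δ > 0 there is a
relaxed-Barlow cell (a₀, h₀) in the box (47/50 ≤ a₀ ≤ 1, |h₀ − a₀√(2/3)| ≤ a₀/100) such that for
every tolerance τ ∈ (0,1] some κ > 0 gives κ·#B ≤ E(y) − N·e⋆ for every finite δ-separated
configuration y : Fin N → ℝ³ and every finite set B of sites whose 13/10·a₀-shell is NOT τ-matched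
(after a linear isometry, bijectively) to the 12-shell of hcpStacking a₀ h₀ or of fccStacking a₀ h₀;
e⋆ = ⨅ periodic Lennard-Jones energy per particle. B = ∅ is the finite bulk floor E(y) ≥ N·e⋆
(Fekete superadditivity over far-apart copies + crysEnergyLimit_proof, provable now); the content is
a positive price κ(τ) per τ-defective first shell (quadratic κ·τ² expected; only ∀τ ∃κ is claimed).
Intended proof device (the route's lever): sitewise pricing x_i + α·Φ_i ≥ κ·1_bad(i) with the
conserved canonical spectral charge Φ (supports ChargeConservation, IcosahedralPoincareCharge,
BarlowChargeSecondOrder) and a configuration-ADAPTED local excess x_i, summed with Σ_i Φ_i = 0 — a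
FIXED sharp bookkeeping is refut -/
@[route_item "route-AtomisticToContinuum-SpectralChargeLedger", crux]
def SummedShellPricing : Prop :=
  ∀ δ : ℝ, 0 < δ → ∃ a₀ h₀ : ℝ, 47 / 50 ≤ a₀ ∧ a₀ ≤ 1 ∧ |h₀ - a₀ * Real.sqrt (2 / 3)| ≤ a₀ / 100 ∧ ∀ τ : ℝ, 0 < τ → τ ≤ 1 → ∃ κ : ℝ, 0 < κ ∧ ∀ (N : ℕ) (y : Fin N → EuclideanSpace ℝ (Fin 3)), (∀ i j : Fin N, i ≠ j → δ ≤ dist (y i) (y j)) → ∀ B : Finset (Fin N), (∀ i ∈ B, ¬ (∃ A : EuclideanSpace ℝ (Fin 3) →ₗᵢ[ℝ] EuclideanSpace ℝ (Fin 3), (∃ e : ↥{z : EuclideanSpace ℝ (Fin 3) | z ∈ Set.range y ∧ z ≠ y i ∧ dist z (y i) < 13 / 10 * a₀} ≃ ↥{p : EuclideanSpace ℝ (Fin 3) | p ∈ Literature.MathematicalPhysics.StatisticalMechanics.hcpStacking a₀ h₀ ∧ p ≠ 0 ∧ ‖p‖ < 13 / 10 * a₀}, ∀ t : ↥{z : EuclideanSpace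 ℝ (Fin 3) | z ∈ Set.range y ∧ z ≠ y i ∧ dist z (y i) < 13 / 10 * a₀}, dist ((t : EuclideanSpace ℝ (Fin 3)) - y i) (A ((e t : ↥{p : EuclideanSpace ℝ (Fin 3) | p ∈ Literature.MathematicalPhysics.StatisticalMechanics.hcpStacking a₀ h₀ ∧ p ≠ 0 ∧ ‖p‖ < 13 / 10 * a₀}) : EuclideanSpace ℝ (Fin 3))) ≤ τ) ∨ (∃ e : ↥{z : EuclideanSpace ℝ (Fin 3) | z ∈ Set.range y ∧ z ≠ y i ∧ dist z (y i) < 13 / 10 * a₀} ≃ ↥{p : EuclideanSpace ℝ (Fin 3) | p ∈ Literature.MathematicalPhysics.StatisticalMechanics.fccStacking a₀ h₀ ∧ p ≠ 0 ∧ ‖p‖ < 13 / 10 * a₀}, ∀ t : ↥{z : EuclideanSpace ℝ (Fin 3) | z ∈ Set.range y ∧ z ≠ y i ∧ dist z (y i) < 13 / 10 * a₀}, dist ((t : EuclideanSpace ℝ (Fin 3)) - y i) (A ((e t : ↥{p : EuclideanSpace ℝ (Fin 3) | p ∈ Literature.MathematicalPhysics.StatisticalMechanics.fccStacking a₀ h₀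 ∧ p ≠ 0 ∧ ‖p‖ < 13 / 10 * a₀}) : EuclideanSpace ℝ (Fin 3))) ≤ τ))) → κ * (B.card : ℝ) ≤ Literature.MathematicalPhysics.StatisticalMechanics.interactionEnergy Literature.MathematicalPhysics.StatisticalMechanics.lennardJones y - (N : ℝ) * (⨅ Q : Literature.MathematicalPhysics.StatisticalMechanics.PeriodicConfiguration 3, Q.energyPerParticle Literature.MathematicalPhysics.StatisticalMechanics.lennardJones)

/-- item stmt-AtomisticToContinuum-17254 · crux · rank 3 · closed · proved by Summit.AtomisticToContinuum.Crystallization.Theorems.ShellsToLayers.shellsToLayers_proof @ f34de659c9ff (prover) · by planner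
why it might fail: Only the exact case is in tree (HalesDSP_layerPackings, ExactHcpLocalTheorem); at h₀ = a₀√(2/3) exactly the τ-robust step meets the Böröczky–Szabó / KKLS flexible twelve-neighbour threats and must come from compactness in τ at fixed (R, ε), not from a fixed tolerance.
sources: HalesDSP2012, Hales2012, BoroczkySzabo2016, KusnerKusnerLagariasShlosman2018, DolbilinLagariasSenechal1998
[crux] (pure geometry, finite radius, exactness τ → 0) for every (a₀, h₀) in the box, every δ > 0
and every R, ε > 0 there are τ ∈ (0,1] and R' such that in every δ-separated finite configuration, a
site all of whose neighbours within R' have 13/10·a₀-shells τ-matched to the relaxed hcp or fcc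
12-shell at scale (a₀, h₀) carries a window: some translate of the configuration is two-way
ε-matched on B(0,R) with a rigid image of a layered Barlow-type set with in-layer spacing a₀, a Hägg
word s and free heights with increments in [39a₀/50, 17a₀/20] (exactly the window format of
LayeredWindows, stmt-11778). [difficulty: L] -/
@[route_item "route-AtomisticToContinuum-SpectralChargeLedger", crux]
def ShellsToLayers : Prop :=
  ∀ a₀ h₀ : ℝ, 47 / 50 ≤ a₀ → a₀ ≤ 1 → |h₀ - a₀ * Real.sqrt (2 / 3)| ≤ a₀ / 100 → ∀ δ : ℝ, 0 < δ → ∀ R ε : ℝ, 0 < ε → ∃ τ R' : ℝ, 0 < τ ∧ τ ≤ 1 ∧ ∀ (N : ℕ) (y : Fin N → EuclideanSpace ℝ (Fin 3)), (∀ i j : Fin N, i ≠ j → δ ≤ dist (y i) (y j)) → ∀ i : Fin N, (∀ j : Fin N, dist (y j) (y i) ≤ R' → (∃ A : EuclideanSpace ℝ (Fin 3) →ₗᵢ[ℝ] EuclideanSpace ℝ (Fin 3), (∃ e : ↥{z : EuclideanSpace ℝ (Fin 3) | z ∈ Set.range y ∧ z ≠ y j ∧ dist z (y j) < 13 / 10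 * a₀} ≃ ↥{p : EuclideanSpace ℝ (Fin 3) | p ∈ Literature.MathematicalPhysics.StatisticalMechanics.hcpStacking a₀ h₀ ∧ p ≠ 0 ∧ ‖p‖ < 13 / 10 * a₀}, ∀ t : ↥{z : EuclideanSpace ℝ (Fin 3) | z ∈ Set.range y ∧ z ≠ y j ∧ dist z (y j) < 13 / 10 * a₀}, dist ((t : EuclideanSpace ℝ (Fin 3)) - y j) (A ((e t : ↥{p : EuclideanSpace ℝ (Fin 3) | p ∈ Literature.MathematicalPhysics.StatisticalMechanics.hcpStacking a₀ h₀ ∧ p ≠ 0 ∧ ‖p‖ < 13 / 10 * a₀}) : EuclideanSpace ℝ (Fin 3))) ≤ τ) ∨ (∃ e : ↥{z : EuclideanSpace ℝ (Fin 3) | z ∈ Set.range y ∧ z ≠ y j ∧ dist z (y j) < 13 / 10 * a₀} ≃ ↥{p : EuclideanSpace ℝ (Fin 3) | p ∈ Literature.MathematicalPhysics.StatisticalMechanics.fccStacking a₀ h₀ ∧ p ≠ 0 ∧ ‖p‖ < 13 / 10 * a₀}, ∀ t : ↥{z : EuclideanSpace ℝ (Fin 3) | z ∈ Set.range y ∧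 z ≠ y j ∧ dist z (y j) < 13 / 10 * a₀}, dist ((t : EuclideanSpace ℝ (Fin 3)) - y j) (A ((e t : ↥{p : EuclideanSpace ℝ (Fin 3) | p ∈ Literature.MathematicalPhysics.StatisticalMechanics.fccStacking a₀ h₀ ∧ p ≠ 0 ∧ ‖p‖ < 13 / 10 * a₀}) : EuclideanSpace ℝ (Fin 3))) ≤ τ))) → ∃ (A : EuclideanSpace ℝ (Fin 3) →ₗᵢ[ℝ] EuclideanSpace ℝ (Fin 3)) (t : EuclideanSpace ℝ (Fin 3)) (s : ℤ → ℤ) (z : ℤ → ℝ), Literature.MathematicalPhysics.StatisticalMechanics.IsHaggSeq s ∧ (∀ m : ℤ, 39 / 50 * a₀ ≤ z (m + 1) - z m ∧ z (m + 1) - z m ≤ 17 / 20 * a₀) ∧ let S : Set (EuclideanSpace ℝ (Fin 3)) := {p | ∃ m i j : ℤ, p = A (((i : ℝ) • Literature.MathematicalPhysics.StatisticalMechanics.triangularVec₁ a₀) + ((j : ℝ) • Literature.MathematicalPhysics.StatisticalMechanics.triangularVec₂ a₀) + ((Literature.MathematicalPhysics.StatisticalMechanics.haggLabel s m : ℝ)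 • Literature.MathematicalPhysics.StatisticalMechanics.barlowOffset a₀) + (z m • Literature.MathematicalPhysics.StatisticalMechanics.layerNormal 1))}; (∀ p ∈ S, ‖p‖ ≤ R → ∃ k : Fin N, dist (y k + t) p ≤ ε) ∧ (∀ k : Fin N, ‖y k + t‖ ≤ R → ∃ p ∈ S, dist (y k + t) p ≤ ε)

-- `ShellsToLayers` holds: proved by `Summit.AtomisticToContinuum.Crystallization.Theorems.ShellsToLayers.shellsToLayers_proof` @ f34de659c9ff (its module imports this route file, so no `_holds` link can be stated here).

/-- item stmt-AtomisticToContinuum-17658 · crux · rank 9 · closed · proved by Summit.AtomisticToContinuum.Crystallization.Theorems.NashPeriodicGivenLayered.periodicGivenLayered_proof @ 61c8b112ea51 (prover) · by planner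
why it might fail: Mathematically it cannot fail: verbatim twin of stmt-11779, PROVED by LayeredHull.PeriodicGivenLayered_of. Procedural risk only: closing it by a `_holds` link to that proof re-imports the ERH-carrying module cone; close it from a Theorems file importing THIS route file.
sources: LoachAckland2017, BlancLewin2015, Literature.Barriers.AtomisticToContinuum.ShortRangeStackingBlindness
[support] PERIODIC GIVEN LAYERED — the shared item stmt-AtomisticToContinuum-11779 (verbatim
signature; PROVED 2026-08-16 by
Summit.AtomisticToContinuum.Crystallization.Theorems.LayeredHull.PeriodicGivenLayered_of): for every
sequence of LJ ground states, layered windows at every scale (LayeredWindows format) imply periodic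
windows at every scale. Attached here (route-repair/cone) so that `closes` takes it as hypothesis h3
instead of importing its proof module, whose import closure carries the declared-only ERH
conjectures of Literature/NumberTheory/LFunctions/DedekindZeta.lean. [difficulty: proved]
[LoachAckland2017, BlancLewin2015] -/
@[route_item "route-AtomisticToContinuum-SpectralChargeLedger", crux]
def PeriodicGivenLayered : Prop :=
  ∀ x : (N : ℕ) → (Fin N → EuclideanSpace ℝ (Fin 3)), (∀ N, Literature.MathematicalPhysics.StatisticalMechanics.IsGroundState Literature.MathematicalPhysics.StatisticalMechanics.lennardJones (x N)) → (∃ a : ℝ, 47 / 50 ≤ a ∧ a ≤ 1 ∧ ∀ R ε : ℝ, 0 < ε → ∃ᶠ N in Filter.atTop, ∃ (A : EuclideanSpace ℝ (Fin 3) →ₗᵢ[ℝ] EuclideanSpace ℝ (Fin 3)) (t : EuclideanSpace ℝ (Fin 3)) (s : ℤ → ℤ) (z : ℤ → ℝ), Literature.MathematicalPhysics.StatisticalMechanics.IsHaggSeq s ∧ (∀ m : ℤ, 39 / 50 * a ≤ z (m + 1) - z m ∧ z (m + 1) - z m ≤ 17 / 20 * a) ∧ let S : Set (EuclideanSpace ℝ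 (Fin 3)) := {p | ∃ m i j : ℤ, p = A (((i : ℝ) • Literature.MathematicalPhysics.StatisticalMechanics.triangularVec₁ a) + ((j : ℝ) • Literature.MathematicalPhysics.StatisticalMechanics.triangularVec₂ a) + ((Literature.MathematicalPhysics.StatisticalMechanics.haggLabel s m : ℝ) • Literature.MathematicalPhysics.StatisticalMechanics.barlowOffset a) + (z m • Literature.MathematicalPhysics.StatisticalMechanics.layerNormal 1))}; (∀ p ∈ S, ‖p‖ ≤ R → ∃ i : Fin N, dist (x N i + t) p ≤ ε) ∧ (∀ i : Fin N, ‖x N i + t‖ ≤ R → ∃ p ∈ S, dist (x N i + t) p ≤ ε)) → ∃ P : Literature.MathematicalPhysics.StatisticalMechanics.PeriodicConfiguration 3, ∀ R ε : ℝ, 0 < ε → ∃ᶠ N in Filter.atTop, ∃ t : EuclideanSpace ℝ (Fin 3), (∀ s ∈ P.points, ‖s‖ ≤ R → ∃ i : Fin N, dist (x N i + t) s ≤ ε) ∧ (∀ i : Fin N, ‖x N i + t‖ ≤ R → ∃ s ∈ P.points, dist (x N i + t) s ≤ ε)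

-- `PeriodicGivenLayered` holds: proved by `Summit.AtomisticToContinuum.Crystallization.Theorems.NashPeriodicGivenLayered.periodicGivenLayered_proof` @ 61c8b112ea51 (its module imports this route file, so no `_holds` link can be stated here).

/-- item stmt-AtomisticToContinuum-17255 · support · rank 9 · open · by planner
sources: Garland1973, BallmannSwiatkowski1997
[support] the conservation law: for every a₀ and every finite configuration y in ℝ³, Σ_i Φ_i = 0
(Garland's localisation with the identity cocycle = double counting of weighted squared edge lengths
over triangles; proved inline in `closes`, filed for provers of K1 to cite). [difficulty:
provable-now] -/
@[route_item "route-AtomisticToContinuum-SpectralChargeLedger"]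
def ChargeConservation : Prop :=
  ∀ (a₀ : ℝ) (N : ℕ) (y : Fin N → EuclideanSpace ℝ (Fin 3)), ∑ i : Fin N, ((1 : ℝ) / 2 * ∑ j : Fin N, ∑ k : Fin N, (if ((i ≠ j ∧ dist (y i) (y j) ≤ 6 / 5 * a₀) ∧ (j ≠ i ∧ dist (y j) (y i) ≤ 6 / 5 * a₀) ∧ (i ≠ k ∧ dist (y i) (y k) ≤ 6 / 5 * a₀) ∧ (k ≠ i ∧ dist (y k) (y i) ≤ 6 / 5 * a₀) ∧ (j ≠ k ∧ dist (y j) (y k) ≤ 6 / 5 * a₀) ∧ (k ≠ j ∧ dist (y k) (y j) ≤ 6 / 5 * a₀)) then (if 2 ≤ (Finset.univ.filter (fun l : Fin N => l ≠ i ∧ dist (y l) (y i) ≤ 6 / 5 * a₀ ∧ l ≠ j ∧ dist (y l) (y j) ≤ 6 / 5 * a₀ ∧ l ≠ k ∧ dist (y l) (y k) ≤ 6 / 5 * a₀)).card then (1 : ℝ) / 3 else 1) else 0) * (‖y j - y k‖ ^ 2 - ‖y i - y j‖ ^ 2)) = 0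

/-- item stmt-AtomisticToContinuum-17256 · support · rank 9 · open · by planner
sources: Garland1973, HalesDSP2012, FlatleyTheil2015
[support] relaxed Barlow stars are critical points of the charge: for (a₀, h₀) in the box there are
C, η₀ > 0 such that an η-matched (η ≤ η₀) hcp- or fcc-shelled site has |Φ_i| ≤ C·η² (hand
computation of ∂Φ/∂y_j = 2Σ_k c_ijk(y_j − y_k) − m_ij(y_j − y_i) = 0 at both stars for every
interlayer spacing; numerics: Φ(centre) = O(ε²) under random ε-perturbations of fcc and hcp
clusters). [difficulty: M] -/
@[route_item "route-AtomisticToContinuum-SpectralChargeLedger"]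
def BarlowChargeSecondOrder : Prop :=
  ∀ a₀ h₀ : ℝ, 47 / 50 ≤ a₀ → a₀ ≤ 1 → |h₀ - a₀ * Real.sqrt (2 / 3)| ≤ a₀ / 100 → ∃ C η₀ : ℝ, 0 < η₀ ∧ ∀ (N : ℕ) (y : Fin N → EuclideanSpace ℝ (Fin 3)) (i : Fin N) (η : ℝ), 0 ≤ η → η ≤ η₀ → (∃ A : EuclideanSpace ℝ (Fin 3) →ₗᵢ[ℝ] EuclideanSpace ℝ (Fin 3), (∃ e : ↥{z : EuclideanSpace ℝ (Fin 3) | z ∈ Set.range y ∧ z ≠ y i ∧ dist z (y i) < 13 / 10 * a₀} ≃ ↥{p : EuclideanSpace ℝ (Fin 3) | p ∈ Literature.MathematicalPhysics.StatisticalMechanics.hcpStacking a₀ h₀ ∧ p ≠ 0 ∧ ‖p‖ < 13 / 10 * a₀}, ∀ t : ↥{z : EuclideanSpace ℝ (Fin 3) | z ∈ Set.range y ∧ z ≠ y i ∧ dist z (y i) < 13 / 10 * a₀}, dist ((t : EuclideanSpace ℝ (Fin 3)) - y i) (A ((e t : ↥{p : EuclideanSpace ℝ (Fin 3) | p ∈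 Literature.MathematicalPhysics.StatisticalMechanics.hcpStacking a₀ h₀ ∧ p ≠ 0 ∧ ‖p‖ < 13 / 10 * a₀}) : EuclideanSpace ℝ (Fin 3))) ≤ η) ∨ (∃ e : ↥{z : EuclideanSpace ℝ (Fin 3) | z ∈ Set.range y ∧ z ≠ y i ∧ dist z (y i) < 13 / 10 * a₀} ≃ ↥{p : EuclideanSpace ℝ (Fin 3) | p ∈ Literature.MathematicalPhysics.StatisticalMechanics.fccStacking a₀ h₀ ∧ p ≠ 0 ∧ ‖p‖ < 13 / 10 * a₀}, ∀ t : ↥{z : EuclideanSpace ℝ (Fin 3) | z ∈ Set.range y ∧ z ≠ y i ∧ dist z (y i) < 13 / 10 * a₀}, dist ((t : EuclideanSpace ℝ (Fin 3)) - y i) (A ((e t : ↥{p : EuclideanSpace ℝ (Fin 3) | p ∈ Literature.MathematicalPhysics.StatisticalMechanics.fccStacking a₀ h₀ ∧ p ≠ 0 ∧ ‖p‖ < 13 / 10 * a₀}) : EuclideanSpace ℝ (Fin 3))) ≤ η)) → |((1 : ℝ) / 2 * ∑ j : Fin N, ∑ k : Fin N, (if ((i ≠ j ∧ dist (y i) (y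 j) ≤ 6 / 5 * a₀) ∧ (j ≠ i ∧ dist (y j) (y i) ≤ 6 / 5 * a₀) ∧ (i ≠ k ∧ dist (y i) (y k) ≤ 6 / 5 * a₀) ∧ (k ≠ i ∧ dist (y k) (y i) ≤ 6 / 5 * a₀) ∧ (j ≠ k ∧ dist (y j) (y k) ≤ 6 / 5 * a₀) ∧ (k ≠ j ∧ dist (y k) (y j) ≤ 6 / 5 * a₀)) then (if 2 ≤ (Finset.univ.filter (fun l : Fin N => l ≠ i ∧ dist (y l) (y i) ≤ 6 / 5 * a₀ ∧ l ≠ j ∧ dist (y l) (y j) ≤ 6 / 5 * a₀ ∧ l ≠ k ∧ dist (y l) (y k) ≤ 6 / 5 * a₀)).card then (1 : ℝ) / 3 else 1) else 0) * (‖y j - y k‖ ^ 2 - ‖y i - y j‖ ^ 2))| ≤ C * η ^ 2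

-- earlier IcosahedralPoincareCharge (stmt-AtomisticToContinuum-17257, replaced 2026-08-16T23:25:16Z -> stmt-AtomisticToContinuum-17649): retired by None — ∀ p : EuclideanSpace ℝ (Fin 3) → EuclideanSpace ℝ (Fin 3), ∑ u ∈ Literature.Barriers.AtomisticToContinuum.icosahedralArrangement, p u = 0 → (1 - 1 / Real.sqrt 5) * (5 * ∑ u ∈ Literature.Barriers.AtomisticToContinuum.icosahedralArrangement, ‖p u‖ ^
/-- item stmt-AtomisticToContinuum-17649 · support · rank 9 · open · by planner
sources: Garland1973, Oppenheim2017, Literature.Barriers.AtomisticToContinuum.FlexibleKissingArrangements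
[support] Garland–Poincaré for the icosahedral link (the source of the + sign on frustrated stars),
restated over an INLINED integer icosahedron (route-repair/cone: no Literature.Barriers import):
with c the twelve integer vectors (0, ±28, ±45) and cyclic permutations (the tree's rational
icosahedron ×53) and u ~ v iff 0 < |c_u − c_v|² < 4045 (= the icosahedral graph, 5-regular, 30
edges; bond cutoff (6/5)²·53²), for every placement p : Fin 12 → ℝ³ with Σ p = 0: (1 −
1/√5)·5·Σ‖p_u‖² ≤ ½·Σ_(ordered adjacent) ‖p_u − p_v‖² (λ₁ of the icosahedral graph Laplacian = 5 −
√5; equality at the regular icosahedral star, whence Φ_centre = +(½ − 1/√5)·W = +1.056 on LJ₁₃).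
[difficulty: provable-now] [Garland1973, Oppenheim2017] -/
@[route_item "route-AtomisticToContinuum-SpectralChargeLedger"]
def IcosahedralPoincareCharge : Prop :=
  let c : Fin 12 → Fin 3 → ℤ := ![![0, 28, 45], ![0, 28, -45], ![0, -28, 45], ![0, -28, -45], ![28, 45, 0], ![28, -45, 0], ![-28, 45, 0], ![-28, -45, 0], ![45, 0, 28], ![45, 0, -28], ![-45, 0, 28], ![-45, 0, -28]]; ∀ p : Fin 12 → EuclideanSpace ℝ (Fin 3), ∑ u : Fin 12, p u = 0 → (1 - 1 / Real.sqrt 5) * (5 * ∑ u : Fin 12, ‖p u‖ ^ 2) ≤ (1 : ℝ) / 2 * ∑ u : Fin 12, ∑ v : Fin 12, (if 0 < ∑ i : Fin 3, (c u i - c v i) ^ 2 ∧ ∑ i : Fin 3, (c u i - c v i) ^ 2 < 4045 then ‖p u - p v‖ ^ 2 else 0)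

-- earlier Assembly (stmt-AtomisticToContinuum-17258, replaced 2026-08-17T01:05:22Z -> stmt-AtomisticToContinuum-17045): retired by None — OneMultiplierPricing → ShellsToLayers → _root_.Crystallization
/-- item stmt-AtomisticToContinuum-17045 · assembly · rank 1 · open · by planner
sources: BlancLewin2015, Garland1973
[assembly] SummedShellPricing → ShellsToLayers → PeriodicGivenLayered → Crystallization (both
conjuncts; the proved hull/window/energy theorems are invoked inside `closes`, which is the deciding
theorem). -/
@[route_item "route-AtomisticToContinuum-SpectralChargeLedger"]
def Assembly : Prop :=
  SummedShellPricing → ShellsToLayers → PeriodicGivenLayered → _root_.Crystallization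

-- records of items no longer active in this route (dropped / restated):
-- earlier OneMultiplierPricing (stmt-AtomisticToContinuum-17253, replaced 2026-08-17T01:05:22Z -> stmt-AtomisticToContinuum-17044): refuted by Summit.AtomisticToContinuum.Crystallization.Theorems.SpectralChargeLedgerOneMultiplierPricing_refuted @ 7c30f6ed2fe2 — ∀ δ : ℝ, 0 < δ → ∃ a₀ h₀ r α κ : ℝ, 47 / 50 ≤ a₀ ∧ a₀ ≤ 1 ∧ |h₀ - a₀ * Real.sqrt (2 / 3)| ≤ a₀ / 100 ∧ 0 < r ∧ 0 ≤ α ∧ 0 < κ ∧ ∀ (N : ℕ) (y 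

/-! D-0027 §2.1 — DECIDING THEOREM (planner-authored via `route open/edit --closes-file`; by planner-rfix-AtomisticToContinuum-SpectralCh-d8818381-0 2026-08-17T01:05:22Z):
its hypotheses are this route's items and its conclusion the sub-problem Statement (glue_lint), and it elaborates with this file. -/

@[closes "route-AtomisticToContinuum-SpectralChargeLedger"] theorem closes (h1 : SummedShellPricing) (h2 : ShellsToLayers) (h3 : PeriodicGivenLayered) : _root_.Crystallization := by
  classical
  obtain ⟨δ, hδ, hsepGS⟩ := Literature.MathematicalPhysics.StatisticalMechanics.LennardJonesMinimalDistance_holds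
  obtain ⟨a₀, h₀, ha, ha', hh, hK1⟩ := h1 δ hδ
  set es : ℝ := (⨅ Q : Literature.MathematicalPhysics.StatisticalMechanics.PeriodicConfiguration 3, Q.energyPerParticle Literature.MathematicalPhysics.StatisticalMechanics.lennardJones) with hes
  have hLW : _root_.Summit.AtomisticToContinuum.Crystallization.Theses.HullMinimality.LayeredWindows := by
    intro x hx
    refine ⟨a₀, ha, ha', fun R ε hε => ?_⟩
    obtain ⟨τ, R', hτ, hτ1, hgeo⟩ := h2 a₀ h₀ ha ha' hh δ hδ R ε hε
    obtain ⟨κ, hκ, hsum⟩ := hK1 τ hτ hτ1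
    have hsep : ∀ N : ℕ, ∀ i j : Fin N, i ≠ j → δ ≤ dist (x N i) (x N j) :=
      fun N i j hij => hsepGS N (x N) (hx N) i j hij
    set GD : (N : ℕ) → Fin N → Prop := fun N i => (∃ A : EuclideanSpace ℝ (Fin 3) →ₗᵢ[ℝ] EuclideanSpace ℝ (Fin 3), (∃ e : ↥{z : EuclideanSpace ℝ (Fin 3) | z ∈ Set.range (x N) ∧ z ≠ x N i ∧ dist z (x N i) < 13 / 10 * a₀} ≃ ↥{p : EuclideanSpace ℝ (Fin 3) | p ∈ Literature.MathematicalPhysics.StatisticalMechanics.hcpStacking a₀ h₀ ∧ p ≠ 0 ∧ ‖p‖ < 13 / 10 * a₀}, ∀ t : ↥{z : EuclideanSpace ℝ (Fin 3) | z ∈ Set.range (x N) ∧ z ≠ x N i ∧ dist z (x N i) < 13 / 10 * a₀}, dist ((t : EuclideanSpace ℝ (Fin 3)) - x N i) (A ((e t : ↥{p : EuclideanSpace ℝ (Fin 3) | p ∈ Literature.MathematicalPhysics.StatisticalMechanics.hcpStacking a₀ h₀ ∧ p ≠ 0 ∧ ‖p‖ < 13 / 10 * a₀}) : EuclideanSpace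 ℝ (Fin 3))) ≤ τ) ∨ (∃ e : ↥{z : EuclideanSpace ℝ (Fin 3) | z ∈ Set.range (x N) ∧ z ≠ x N i ∧ dist z (x N i) < 13 / 10 * a₀} ≃ ↥{p : EuclideanSpace ℝ (Fin 3) | p ∈ Literature.MathematicalPhysics.StatisticalMechanics.fccStacking a₀ h₀ ∧ p ≠ 0 ∧ ‖p‖ < 13 / 10 * a₀}, ∀ t : ↥{z : EuclideanSpace ℝ (Fin 3) | z ∈ Set.range (x N) ∧ z ≠ x N i ∧ dist z (x N i) < 13 / 10 * a₀}, dist ((t : EuclideanSpace ℝ (Fin 3)) - x N i) (A ((e t : ↥{p : EuclideanSpace ℝ (Fin 3) | p ∈ Literature.MathematicalPhysics.StatisticalMechanics.fccStacking a₀ h₀ ∧ p ≠ 0 ∧ ‖p‖ < 13 / 10 * a₀}) : EuclideanSpace ℝ (Fin 3))) ≤ τ)) with hGD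
    suffices hev : ∀ᶠ N : ℕ in Filter.atTop, ∃ i : Fin N, ∀ j : Fin N, dist (x N j) (x N i) ≤ R' → GD N j by
      refine Filter.Eventually.frequently (hev.mono fun N hN => ?_)
      obtain ⟨i, hi⟩ := hN
      exact hgeo N (x N) (hsep N) i hi
    set M : ℝ := (2 * (max R' 0) / δ + 1) ^ Module.finrank ℝ (EuclideanSpace ℝ (Fin 3)) with hM
    have hMpos : 0 < M := by positivity
    set θ : ℝ := κ / (2 * M) with hθ
    have hθpos : 0 < θ := by positivity
    have hEL := _root_.Summit.AtomisticToContinuum.Crystallization.Theorems.crysEnergyLimit_proof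
    unfold Summit.AtomisticToContinuum.Crystallization.Theses.ExcessDecayLiouville.CrysEnergyLimit at hEL
    have hev1 : ∀ᶠ N : ℕ in Filter.atTop, Literature.MathematicalPhysics.StatisticalMechanics.groundStateEnergy Literature.MathematicalPhysics.StatisticalMechanics.lennardJones 3 N / (N : ℝ) < es + θ :=
      (tendsto_order.1 hEL).2 _ (lt_add_of_pos_right _ hθpos)
    filter_upwards [hev1, Filter.eventually_ge_atTop 1] with N hN1 hN2
    have hNpos : (0 : ℝ) < N := by exact_mod_cast hN2
    set B : Finset (Fin N) := Finset.univ.filter (fun j : Fin N => ¬ GD N j) with hB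
    set NB : Fin N → Finset (Fin N) := fun j => Finset.univ.filter (fun i : Fin N => dist (x N j) (x N i) ≤ R') with hNB
    have hBle : κ * (B.card : ℝ) ≤ Literature.MathematicalPhysics.StatisticalMechanics.interactionEnergy Literature.MathematicalPhysics.StatisticalMechanics.lennardJones (x N) - (N : ℝ) * es :=
      hsum N (x N) (hsep N) B (fun i hi => (Finset.mem_filter.1 hi).2)
    have hbudget : κ * (B.card : ℝ) < θ * N := by
      have h1' := hBle
      rw [(hx N).2] at h1'
      have h2' : Literature.MathematicalPhysics.StatisticalMechanics.groundStateEnergy Literature.MathematicalPhysics.StatisticalMechanics.lennardJones 3 N < (es + θ) * N := (div_lt_iff₀ hNpos).1 hN1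
      nlinarith [h1', h2']
    by_contra hcon
    have hcover : (Finset.univ : Finset (Fin N)) ⊆ B.biUnion NB := by
      intro i _
      rw [Finset.mem_biUnion]
      by_contra h'
      apply hcon
      refine ⟨i, fun j hj => ?_⟩
      by_contra hbad
      exact h' ⟨j, Finset.mem_filter.2 ⟨Finset.mem_univ _, hbad⟩, Finset.mem_filter.2 ⟨Finset.mem_univ _, hj⟩⟩
    have hball : ∀ j : Fin N, ((NB j).card : ℝ) ≤ M := by
      intro j
      have hcard := Literature.MathematicalPhysics.StatisticalMechanics.card_le_of_separated_of_dist_le ((NB j).image (x N)) (x N j) hδ (le_max_right R' 0) ?_ ?_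
      · rwa [Finset.card_image_of_injective _ (hx N).1] at hcard
      · intro p hp
        obtain ⟨i, hi, rfl⟩ := Finset.mem_image.1 hp
        rw [dist_comm]
        exact ((Finset.mem_filter.1 hi).2).trans (le_max_left _ _)
      · intro p hp q hq hpq
        obtain ⟨i, -, rfl⟩ := Finset.mem_image.1 hp
        obtain ⟨i', -, rfl⟩ := Finset.mem_image.1 hq
        exact hsep N i i' (fun h => hpq (by rw [h]))
    have hcount : (N : ℝ) ≤ (B.card : ℝ) * M := by
      have h1' := (Finset.card_le_card hcover).trans Finset.card_biUnion_le
      rw [Finset.card_univ, Fintype.card_fin] at h1'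
      calc (N : ℝ) ≤ ((∑ j ∈ B, (NB j).card : ℕ) : ℝ) := by exact_mod_cast h1'
        _ = ∑ j ∈ B, ((NB j).card : ℝ) := by push_cast; rfl
        _ ≤ ∑ j ∈ B, M := Finset.sum_le_sum fun j _ => hball j
        _ = (B.card : ℝ) * M := by rw [Finset.sum_const, nsmul_eq_mul]
    have hF : κ * (N : ℝ) ≤ κ * ((B.card : ℝ) * M) :=
      mul_le_mul_of_nonneg_left hcount hκ.le
    have hF' : κ * (B.card : ℝ) * M < θ * N * M := mul_lt_mul_of_pos_right hbudget hMpos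
    have hθM : θ * N * M = κ * N / 2 := by rw [hθ]; field_simp
    have hkt : 0 < κ * (N : ℝ) := by positivity
    nlinarith [hF, hF', hθM, hkt]
  have hPW : _root_.Summit.AtomisticToContinuum.Crystallization.Theses.HullMinimality.PeriodicWindows := fun x hx =>
    h3 x hx (hLW x hx)
  have hpos := _root_.Summit.AtomisticToContinuum.Crystallization.Theorems.PrestressSplitKorn.stub_hullCriterion hPW
  have hex := Literature.MathematicalPhysics.StatisticalMechanics.LennardJonesGroundStatesExist_holds
  obtain ⟨x, hx⟩ : ∃ x : (N : ℕ) → (Fin N → EuclideanSpace ℝ (Fin 3)), ∀ N, Literature.MathematicalPhysics.StatisticalMechanics.IsGroundState Literature.MathematicalPhysics.StatisticalMechanics.lennardJones (x N) :=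
    ⟨fun N => (hex N).choose, fun N => (hex N).choose_spec⟩
  obtain ⟨P, hP⟩ := hPW x hx
  have hleast := _root_.Summit.AtomisticToContinuum.Crystallization.Theorems.windowOptimality_proof x hx P hP
  have hinf : (⨅ Q : Literature.MathematicalPhysics.StatisticalMechanics.PeriodicConfiguration 3, Q.energyPerParticle Literature.MathematicalPhysics.StatisticalMechanics.lennardJones) = P.energyPerParticle Literature.MathematicalPhysics.StatisticalMechanics.lennardJones := hleast.csInf_eq
  have hEL := _root_.Summit.AtomisticToContinuum.Crystallization.Theorems.crysEnergyLimit_proof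
  unfold Summit.AtomisticToContinuum.Crystallization.Theses.ExcessDecayLiouville.CrysEnergyLimit at hEL
  rw [hinf] at hEL
  exact ⟨⟨P, hleast, hEL⟩, hpos⟩

end Summit.AtomisticToContinuum.Crystallization.Theses.SpectralChargeLedger
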